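import Summits.NavierStokesRegularity.NavierStokesRegularity.Theses.TypeILiouville
import Literature.Analysis.FluidPDE.AncientMildPairing
import Literature.Analysis.FluidPDE.BoundedAnnihilator
import Literature.Analysis.FluidPDE.KNSSAxisymmetricNoSwirl
import Literature.Analysis.FluidPDE.KNSSRegularityGalileanProofs
import Literature.Analysis.FluidPDE.SolenoidalL2Duality
import Literature.Analysis.FluidPDE.OseenBallAverageMomentum
import Mathlib.MeasureTheory.Integral.Average
import HarnessLib

/-!
# Stub `stub_oseen_gauge_uniform_every_slice` (crux `TypeIliouvilleL`,
# stmt-NavierStokesRegularity-10661, line `registered`): one bound and every slice in the Oseen gauge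

Helper file (lands `--supports stmt-NavierStokesRegularity-10661`; theorems only, no definitions,
no named facts). It finishes the Oseen gauge theorem of the line. A bounded ancient mild solution
`u` of the duality-form class (`IsBoundedAncientMildSolution 1 u`, slices a.e.-strongly measurable)
is given, for a.e. `t < 0`, as a Galilean image `u(t) = V(t, · − A(t)) + b(t)` a.e. in space, of a
jointly continuous field `V` on `(−∞,0) × ℝ³` with weakly divergence-free slices whose mean at
spatial infinity is conserved, `⨍_{B_R} (V(t) − V(s)) → 0` as `R → ∞` (`s < t < 0`; Stub C,
conservation of momentum). Then

* (D) `V` obeys ONE bound on `(−∞,0) × ℝ³`: `‖V(t, y)‖ ≤ K`;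
* (E) the representation holds at EVERY `t < 0` modulo constants: `u(t) = V(t, · − A(t)) + c(t)`
  a.e. in space.

## Proof

Let `‖u‖ ≤ M` and let `G ⊆ (−∞,0)` be the full-measure set of good times. (D) For `t ∈ G` the
closed set `{‖V(t, · − A t) + b t‖ ≤ M}` has full measure, hence is dense
(`Measure.dense_of_ae`), hence is everything: `‖V(t) + b(t)‖ ≤ M` pointwise. For `s < t` in `G`
the ball averages of `V(t) − V(s) = (V(t) + b(t)) − (V(s) + b(s)) + (b(s) − b(t))` stay within `2M`
of `b(s) − b(t)` and tend to `0`, so the parasitic drift has oscillation `‖b(t) − b(s)‖ ≤ 2M`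
(this is where conservation of momentum enters: Koch–Nadirashvili–Seregin–Šverák 2009, §1, the
solutions `b(t)` are invisible to the duality-form class, §4 the Duhamel term does not move the
mean at infinity). Fixing `t₀ ∈ G`, `‖V(t)‖ ≤ 3M + ‖b(t₀)‖ =: K` on `G`, and on all of `(−∞,0)` by
density of `G` and joint continuity of `V`. (E) For a solenoidal test field `φ` the gap of
pairings `g(τ) = ∫⟪u(τ), φ⟫ − ∫⟪V(τ, · − A τ), φ⟫` is continuous on `(−∞,0)` (the first term by
the two-time identity, `IsBoundedAncientMildSolution.continuousOn_integral_inner`; the second by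
dominated convergence against `K‖φ‖`) and vanishes on `G` (constants pair to zero with
solenoidal fields, `integral_inner_const_eq_zero_of_isDivFree`), hence everywhere
(`Measure.eqOn_open_of_ae_eq`). So at every `t < 0` the bounded, weakly divergence-free field
`u(t) − V(t, · − A t)` annihilates the solenoidal tests and is a.e. constant by the `L^∞`
annihilator lemma (`IsWeaklyDivFree.exists_ae_eq_const_of_norm_le_of_forall_integral_inner_eq_zero`,
KNSS 2009 Lemma 3.1: bounded fields with `curl z = 0`, `div z = 0` are constant).

## References

* G. Koch, N. Nadirashvili, G. Seregin, V. Šverák, *Liouville theorems for the Navier–Stokes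
  equations and applications*, Acta Math. 203 (2009) 83–105 = arXiv:0709.3599, §1 p. 3 (the
  parasitic solutions `b(t)`), Lemma 3.1 and Remark 3.1 p. 7, §4 p. 8.
  [KochNadirashviliSereginSverak2009]
-/

-- the summit and its single problem share the name (D-0017 nested layout)
set_option linter.dupNamespace false

noncomputable section

namespace Summit.NavierStokesRegularity.NavierStokesRegularity.Theorems

open MeasureTheory Filter Set Function Metric
open scoped Topology ENNReal RealInnerProductSpace
open Literature.Analysis Literature.Analysis.FluidPDE

namespace TypeIliouvilleL.GaugeEverySlice

/-! ### Good times are dense -/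

/-- A full-measure set of times in `(−∞,0)` reaches every `t < 0` along a sequence (it is dense,
`Measure.dense_of_ae`). [folklore] -/
theorem exists_seq_tendsto_of_ae {p : ℝ → Prop}
    (hp : ∀ᵐ t ∂((volume : Measure ℝ).restrict (Iio 0)), p t) {t : ℝ} (ht : t < 0) :
    ∃ s : ℕ → ℝ, (∀ n, s n < 0 ∧ p (s n)) ∧ Tendsto s atTop (𝓝 t) := by
  -- adapted from `IsKNSSDriftMild.isWeaklyDivFree_of_mem` (`OseenMildWindowRepresentative`)
  have hgood : ∀ᵐ τ ∂(volume : Measure ℝ), τ ∈ {σ : ℝ | σ ∈ Iio (0 : ℝ) → p σ} :=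
    (ae_restrict_iff' measurableSet_Iio).1 hp
  have hdense : Dense {σ : ℝ | σ ∈ Iio (0 : ℝ) → p σ} := Measure.dense_of_ae hgood
  have hsub := hdense.open_subset_closure_inter (isOpen_Iio (a := (0 : ℝ)))
  obtain ⟨sq, hsq, hsql⟩ := mem_closure_iff_seq_limit.1 (hsub (mem_Iio.2 ht))
  exact ⟨sq, fun n => ⟨(hsq n).1, (hsq n).2 (hsq n).1⟩, hsql⟩

variable {E : Type*} [NormedAddCommGroup E] [InnerProductSpace ℝ E] [FiniteDimensional ℝ E]
  [MeasurableSpace E] [BorelSpace E]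

/-! ### (D) One bound for the Oseen-gauge field -/

/-- An a.e. identity `u₀ = W` with `W` continuous upgrades a pointwise bound `‖u₀‖ ≤ M` to the
pointwise bound `‖W‖ ≤ M`: the closed set `{‖W‖ ≤ M}` has full measure, hence is dense, hence is
everything. [folklore] -/
theorem norm_le_of_ae_eq {u₀ W : E → E} (hW : Continuous W) {M : ℝ} (hM : ∀ x, ‖u₀ x‖ ≤ M)
    (hae : u₀ =ᵐ[volume] W) (x : E) : ‖W x‖ ≤ M := by
  have h1 : ∀ᵐ y ∂(volume : Measure E), y ∈ {y : E | ‖W y‖ ≤ M} := by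
    filter_upwards [hae] with y hy
    rw [← hy]
    exact hM y
  have hd : Dense {y : E | ‖W y‖ ≤ M} := Measure.dense_of_ae h1
  have hc : IsClosed {y : E | ‖W y‖ ≤ M} := isClosed_le hW.norm continuous_const
  have hx : x ∈ closure {y : E | ‖W y‖ ≤ M} := hd x
  rwa [hc.closure_eq] at hx

/-- Ball averages of a field staying within `C` of a constant `c` stay within `C` of `c`
(`R > 0`). [folklore] -/
theorem norm_setAverage_ball_sub_le {g : E → E} (hg : AEStronglyMeasurable g volume) {c : E}
    {C : ℝ} (hC : ∀ y, ‖g y - c‖ ≤ C) {R : ℝ} (hR : 0 < R) :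
    ‖(⨍ y in ball (0 : E) R, g y) - c‖ ≤ C := by
  have hμ0 : volume (ball (0 : E) R) ≠ 0 := (measure_ball_pos volume (0 : E) hR).ne'
  have hμ : volume (ball (0 : E) R) ≠ ∞ := measure_ball_lt_top.ne
  have hv0 : 0 < (volume : Measure E).real (ball (0 : E) R) := by
    rw [measureReal_def]
    exact ENNReal.toReal_pos hμ0 hμ
  have hint : IntegrableOn g (ball (0 : E) R) volume := by
    refine Measure.integrableOn_of_bounded (M := C + ‖c‖) hμ hg (Eventually.of_forall fun y => ?_)
    calc ‖g y‖ = ‖(g y - c) + c‖ := by rw [sub_add_cancel]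
      _ ≤ ‖g y - c‖ + ‖c‖ := norm_add_le _ _
      _ ≤ C + ‖c‖ := by gcongr; exact hC y
  have h1 : (⨍ y in ball (0 : E) R, g y) - c =
      ((volume : Measure E).real (ball (0 : E) R))⁻¹ • ∫ y in ball (0 : E) R, (g y - c) := by
    rw [setAverage_eq, integral_sub hint (integrableOn_const hμ), setIntegral_const, smul_sub,
      inv_smul_smul₀ hv0.ne']
  rw [h1, norm_smul, norm_inv, Real.norm_of_nonneg hv0.le]
  calc ((volume : Measure E).real (ball (0 : E) R))⁻¹ * ‖∫ y in ball (0 : E) R, (g y - c)‖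
      ≤ ((volume : Measure E).real (ball (0 : E) R))⁻¹ *
          (C * (volume : Measure E).real (ball (0 : E) R)) := by
        gcongr
        exact norm_setIntegral_le_of_norm_le_const measure_ball_lt_top fun y _ => hC y
    _ = C := by field_simp

/-- **Oscillation of the parasitic drift.** If `‖V_t + b_t‖ ≤ M` and `‖V_s + b_s‖ ≤ M` pointwise
(`V_t`, `V_s` continuous) and the ball averages of `V_t − V_s` tend to `0` as the radius tends to
`∞` (conservation of momentum at infinity), then `‖b_t − b_s‖ ≤ 2M`. [folklore] -/
theorem norm_sub_le_of_tendsto_setAverage {Vt Vs : E → E} {bt bs : E} {M : ℝ}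
    (hVt : Continuous Vt) (hVs : Continuous Vs)
    (ht : ∀ y, ‖Vt y + bt‖ ≤ M) (hs : ∀ y, ‖Vs y + bs‖ ≤ M)
    (hmom : Tendsto (fun R : ℝ => ⨍ y in ball (0 : E) R, (Vt y - Vs y)) atTop (𝓝 0)) :
    ‖bt - bs‖ ≤ 2 * M := by
  have hb : ∀ R : ℝ, 0 < R → ‖(⨍ y in ball (0 : E) R, (Vt y - Vs y)) - (bs - bt)‖ ≤ 2 * M := by
    intro R hR
    refine norm_setAverage_ball_sub_le (hVt.sub hVs).aestronglyMeasurable (fun y => ?_) hR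
    calc ‖Vt y - Vs y - (bs - bt)‖ = ‖(Vt y + bt) - (Vs y + bs)‖ := by congr 1; abel
      _ ≤ ‖Vt y + bt‖ + ‖Vs y + bs‖ := norm_sub_le _ _
      _ ≤ M + M := add_le_add (ht y) (hs y)
      _ = 2 * M := by ring
  have hlim : Tendsto (fun R : ℝ => ‖(⨍ y in ball (0 : E) R, (Vt y - Vs y)) - (bs - bt)‖) atTop
      (𝓝 ‖(0 : E) - (bs - bt)‖) := (hmom.sub_const _).norm
  have h := le_of_tendsto hlim ((eventually_gt_atTop 0).mono hb)
  rwa [zero_sub, norm_neg, norm_sub_rev] at h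

/-- **(D) One bound for the Oseen-gauge field.** With `‖u‖ ≤ M` on `(−∞,0)`, `V` jointly
continuous on `(−∞,0) × E`, conservation of momentum at infinity between any two slices of `V`,
and `u(t) = V(t, · − A t) + b t` a.e. for a.e. `t < 0`: `‖V(t,y)‖ ≤ K` for all `t < 0`, `y`.
(On good times `‖V(t) + b(t)‖ ≤ M` pointwise and `b` has oscillation `≤ 2M`; density of the good
times and joint continuity of `V`.) [folklore] -/
theorem uniform_bound {u V : ℝ → E → E} {A b : ℝ → E} {M : ℝ} (hM : ∀ t < 0, ∀ x, ‖u t x‖ ≤ M)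
    (hV : ContinuousOn (uncurry V) (Iio 0 ×ˢ univ))
    (hmom : ∀ s t : ℝ, s < t → t < 0 →
      Tendsto (fun R : ℝ => ⨍ y in ball (0 : E) R, (V t y - V s y)) atTop (𝓝 0))
    (hrep : ∀ᵐ t ∂((volume : Measure ℝ).restrict (Iio 0)),
      u t =ᵐ[volume] fun x => V t (x - A t) + b t) :
    ∃ K : ℝ, ∀ t < 0, ∀ y, ‖V t y‖ ≤ K := by
  -- slices of `V` are continuous (restrict along `y ↦ (t, y)`)
  have hVc : ∀ t < 0, Continuous (V t) := fun t ht =>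
    hV.comp_continuous (Continuous.prodMk_right t) fun y => ⟨ht, mem_univ y⟩
  -- on good times `‖V t + b t‖ ≤ M` pointwise
  have hG : ∀ t < 0, (u t =ᵐ[volume] fun x => V t (x - A t) + b t) → ∀ y, ‖V t y + b t‖ ≤ M := by
    intro t ht hae y
    have hW : Continuous fun x => V t (x - A t) + b t :=
      ((hVc t ht).comp (continuous_id.sub continuous_const)).add continuous_const
    have h := norm_le_of_ae_eq hW (hM t ht) hae (y + A t)
    rwa [add_sub_cancel_right] at h
  -- oscillation of `b` over good times
  have hosc : ∀ s t : ℝ, s < 0 → t < 0 → (u s =ᵐ[volume] fun x => V s (x - A s) + b s) →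
      (u t =ᵐ[volume] fun x => V t (x - A t) + b t) → ‖b t - b s‖ ≤ 2 * M := by
    intro s t hs ht hse hte
    rcases lt_trichotomy s t with hst | rfl | hts
    · exact norm_sub_le_of_tendsto_setAverage (hVc t ht) (hVc s hs) (hG t ht hte) (hG s hs hse)
        (hmom s t hst ht)
    · have hM0 : 0 ≤ M := (norm_nonneg _).trans (hM s hs (A s))
      rw [sub_self, norm_zero]
      positivity
    · rw [norm_sub_rev]
      exact norm_sub_le_of_tendsto_setAverage (hVc s hs) (hVc t ht) (hG s hs hse) (hG t ht hte)
        (hmom t s hts hs)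
  -- one good time
  obtain ⟨sq, hsq, -⟩ := exists_seq_tendsto_of_ae hrep neg_one_lt_zero
  refine ⟨M + 2 * M + ‖b (sq 0)‖, fun t ht y => ?_⟩
  -- good times accumulate at `t`; pass to the limit by joint continuity
  obtain ⟨tn, htn, htnl⟩ := exists_seq_tendsto_of_ae hrep ht
  have hlim : Tendsto (fun n => V (tn n) y) atTop (𝓝 (V t y)) := by
    have hca : ContinuousAt (uncurry V) (t, y) :=
      hV.continuousAt ((isOpen_Iio.prod isOpen_univ).mem_nhds ⟨ht, mem_univ y⟩)
    exact hca.tendsto.comp (htnl.prodMk_nhds tendsto_const_nhds)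
  refine le_of_tendsto' hlim.norm fun n => ?_
  have h1 : ‖V (tn n) y + b (tn n)‖ ≤ M := hG _ (htn n).1 (htn n).2 y
  have h2 : ‖b (tn n) - b (sq 0)‖ ≤ 2 * M :=
    hosc (sq 0) (tn n) (hsq 0).1 (htn n).1 (hsq 0).2 (htn n).2
  calc ‖V (tn n) y‖ = ‖(V (tn n) y + b (tn n)) - (b (tn n) - b (sq 0)) - b (sq 0)‖ := by
        congr 1; abel
    _ ≤ ‖(V (tn n) y + b (tn n)) - (b (tn n) - b (sq 0))‖ + ‖b (sq 0)‖ := norm_sub_le _ _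
    _ ≤ ‖V (tn n) y + b (tn n)‖ + ‖b (tn n) - b (sq 0)‖ + ‖b (sq 0)‖ := by
        gcongr; exact norm_sub_le _ _
    _ ≤ M + 2 * M + ‖b (sq 0)‖ := by gcongr

/-! ### (E) The representation at every slice, modulo constants -/

/-- The pairing `τ ↦ ∫ ⟪V(τ, x − A τ), φ x⟫ dx` of a bounded, jointly continuous co-moving field
with a continuous compactly supported `φ` is continuous on `(−∞,0)` (dominated convergence
against `K‖φ‖`). [folklore] -/
theorem continuousOn_integral_inner_comoving {V : ℝ → E → E} {A : ℝ → E}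
    (hV : ContinuousOn (uncurry V) (Iio 0 ×ˢ univ)) (hA : Continuous A)
    {K : ℝ} (hK : ∀ t < 0, ∀ y, ‖V t y‖ ≤ K) {φ : E → E} (hφc : Continuous φ)
    (hφs : HasCompactSupport φ) :
    ContinuousOn (fun τ => ∫ x, ⟪V τ (x - A τ), φ x⟫) (Iio 0) := by
  refine continuousOn_of_dominated (bound := fun x => K * ‖φ x‖) ?_ ?_ ?_ ?_
  · intro τ hτ
    have hVτ : Continuous (V τ) :=
      hV.comp_continuous (Continuous.prodMk_right τ) fun y => ⟨hτ, mem_univ y⟩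
    exact ((hVτ.comp (continuous_id.sub continuous_const)).inner hφc).aestronglyMeasurable
  · intro τ hτ
    exact Eventually.of_forall fun x => (norm_inner_le_norm _ _).trans
      (mul_le_mul_of_nonneg_right (hK τ hτ _) (norm_nonneg _))
  · exact (hφc.norm.integrable_of_hasCompactSupport hφs.norm).const_mul K
  · refine Eventually.of_forall fun x => ?_
    have h2 : ContinuousOn (fun τ : ℝ => (τ, x - A τ)) (Iio 0) :=
      (continuous_id.prodMk (continuous_const.sub hA)).continuousOn
    have h1 : ContinuousOn (fun τ => V τ (x - A τ)) (Iio 0) :=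
      hV.comp h2 fun τ hτ => ⟨hτ, mem_univ _⟩
    exact h1.inner continuousOn_const

/-- **The gap of pairings vanishes at every `t < 0`.** For a solenoidal test field `φ`,
`∫ ⟪u(t), φ⟫ = ∫ ⟪V(t, · − A t), φ⟫` at EVERY `t < 0`: both pairings are continuous on `(−∞,0)`
(`IsBoundedAncientMildSolution.continuousOn_integral_inner`, `continuousOn_integral_inner_comoving`)
and they agree at a.e. `t` since constants pair to zero with solenoidal fields
(`integral_inner_const_eq_zero_of_isDivFree`); `Measure.eqOn_open_of_ae_eq`. [folklore] -/
theorem integral_inner_sub_eq_zero {u V : ℝ → E → E} {A b : ℝ → E}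
    (hu : IsBoundedAncientMildSolution 1 u) (hmeas : ∀ t < 0, AEStronglyMeasurable (u t) volume)
    (hA : Continuous A) (hV : ContinuousOn (uncurry V) (Iio 0 ×ˢ univ))
    {K : ℝ} (hK : ∀ t < 0, ∀ y, ‖V t y‖ ≤ K)
    (hrep : ∀ᵐ t ∂((volume : Measure ℝ).restrict (Iio 0)),
      u t =ᵐ[volume] fun x => V t (x - A t) + b t)
    {φ : E → E} (hφ : FunctionSpaces.IsTestFunctionOn (⊤ : TopologicalSpace.Opens E) φ)
    (hdiv : VectorCalculus.IsDivFree φ) :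
    ∀ t < 0, (∫ x, ⟪u t x, φ x⟫) - ∫ x, ⟪V t (x - A t), φ x⟫ = 0 := by
  -- adapted from `IsBoundedAncientMildSolution.exists_ae_eq_const_of_ae_restrict`
  -- (`KNSSLiouvilleBridge`)
  have hφc : Continuous φ := hφ.contDiff.continuous
  have hφ1 : ContDiff ℝ 1 φ := hφ.contDiff.of_le (by exact_mod_cast le_top)
  have hcont : ContinuousOn (fun t => (∫ x, ⟪u t x, φ x⟫) - ∫ x, ⟪V t (x - A t), φ x⟫)
      (Iio 0) :=
    (hu.continuousOn_integral_inner one_pos hmeas hφ hdiv).fun_sub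
      (continuousOn_integral_inner_comoving hV hA hK hφc hφ.hasCompactSupport)
  have hae : (fun t => (∫ x, ⟪u t x, φ x⟫) - ∫ x, ⟪V t (x - A t), φ x⟫)
      =ᵐ[(volume : Measure ℝ).restrict (Iio 0)] fun _ => (0 : ℝ) := by
    filter_upwards [hrep, ae_restrict_mem measurableSet_Iio] with τ hτ hτ0
    have hVτ : Continuous (V τ) :=
      hV.comp_continuous (Continuous.prodMk_right τ) fun y => ⟨hτ0, mem_univ y⟩
    have iV : Integrable (fun x => ⟪V τ (x - A τ), φ x⟫) (volume : Measure E) :=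
      integrable_inner_of_locallyIntegrable_of_hasCompactSupport
        (hVτ.comp (continuous_id.sub continuous_const)).locallyIntegrable hφc hφ.hasCompactSupport
    have ib : Integrable (fun x : E => ⟪b τ, φ x⟫) (volume : Measure E) :=
      integrable_inner_of_locallyIntegrable_of_hasCompactSupport (locallyIntegrable_const (b τ))
        hφc hφ.hasCompactSupport
    have h1 : ∫ x, ⟪u τ x, φ x⟫ = ∫ x, ⟪V τ (x - A τ) + b τ, φ x⟫ :=
      integral_congr_ae (by filter_upwards [hτ] with x hx; rw [hx])
    rw [h1]
    simp_rw [inner_add_left]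
    rw [integral_add iV ib, integral_inner_const_eq_zero_of_isDivFree (b τ) hφ1
      hφ.hasCompactSupport hdiv, add_zero, sub_self]
  intro t ht
  exact Measure.eqOn_open_of_ae_eq hae isOpen_Iio hcont continuousOn_const ht

/-- **(E) The representation at every slice, modulo constants.** At every `t < 0` the field
`u(t) − V(t, · − A t)` is bounded, a.e.-strongly measurable, weakly divergence free and
annihilates the solenoidal test fields (`integral_inner_sub_eq_zero`), hence is a.e. a constant
`c` by the `L^∞` annihilator lemma (KNSS 2009, Lemma 3.1): `u(t) = V(t, · − A t) + c` a.e.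
[folklore] -/
theorem exists_const_slice {u V : ℝ → E → E} {A b : ℝ → E}
    (hu : IsBoundedAncientMildSolution 1 u) (hmeas : ∀ t < 0, AEStronglyMeasurable (u t) volume)
    (hA : Continuous A) (hV : ContinuousOn (uncurry V) (Iio 0 ×ˢ univ))
    (hVdiv : ∀ t < 0, IsWeaklyDivFree (V t))
    {K : ℝ} (hK : ∀ t < 0, ∀ y, ‖V t y‖ ≤ K)
    (hrep : ∀ᵐ t ∂((volume : Measure ℝ).restrict (Iio 0)),
      u t =ᵐ[volume] fun x => V t (x - A t) + b t)
    {t : ℝ} (ht : t < 0) :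
    ∃ c : E, u t =ᵐ[volume] fun x => V t (x - A t) + c := by
  obtain ⟨M, hM⟩ := hu.2
  have hWc : Continuous fun x => V t (x - A t) :=
    (hV.comp_continuous (Continuous.prodMk_right t) fun y => ⟨ht, mem_univ y⟩ :
      Continuous (V t)).comp (continuous_id.sub continuous_const)
  have hul : LocallyIntegrable (u t) volume :=
    (memLp_top_of_bound (hmeas t ht) M (Eventually.of_forall (hM t ht))).locallyIntegrable le_top
  have hw_meas : AEStronglyMeasurable (u t - fun x => V t (x - A t)) volume :=
    (hmeas t ht).sub hWc.aestronglyMeasurable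
  have hw_bd : ∀ x, ‖(u t - fun x => V t (x - A t)) x‖ ≤ M + K := fun x =>
    (norm_sub_le _ _).trans (add_le_add (hM t ht x) (hK t ht _))
  have hw_div : IsWeaklyDivFree (u t - fun x => V t (x - A t)) :=
    (hu.1.1 t ht).sub_of_locallyIntegrable ((hVdiv t ht).comp_sub_right (A t)) hul
      hWc.locallyIntegrable
  obtain ⟨c, hc⟩ :=
    IsWeaklyDivFree.exists_ae_eq_const_of_norm_le_of_forall_integral_inner_eq_zero hw_meas hw_bd
      hw_div fun φ hφ hdiv => by
        have hφc : Continuous φ := hφ.contDiff.continuous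
        have iu : Integrable (fun x => ⟪u t x, φ x⟫) (volume : Measure E) :=
          integrable_inner_of_locallyIntegrable_of_hasCompactSupport hul hφc hφ.hasCompactSupport
        have iW : Integrable (fun x => ⟪V t (x - A t), φ x⟫) (volume : Measure E) :=
          integrable_inner_of_locallyIntegrable_of_hasCompactSupport hWc.locallyIntegrable hφc
            hφ.hasCompactSupport
        simp only [Pi.sub_apply, inner_sub_left]
        rw [integral_sub iu iW]
        exact integral_inner_sub_eq_zero hu hmeas hA hV hK hrep hφ hdiv t ht
  refine ⟨c, ?_⟩
  filter_upwards [hc] with x hx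
  simp only [Pi.sub_apply] at hx
  exact sub_eq_iff_eq_add'.1 hx

end TypeIliouvilleL.GaugeEverySlice

open TypeIliouvilleL.GaugeEverySlice in
/-- **Stub DE (one bound and every slice in the Oseen gauge).** Let `u` be a bounded ancient mild
solution of the duality-form class (`ν = 1`) with a.e.-strongly measurable slices, represented for
a.e. `t < 0` as `u(t) = V(t, · − A(t)) + b(t)` a.e. in space, where `A` is continuous, `V` is
jointly continuous on `(−∞,0) × ℝ³` with weakly divergence-free slices, and the mean of `V` at
spatial infinity is conserved (`⨍_{B_R} (V(t) − V(s)) → 0` as `R → ∞`, `s < t < 0`: Stub C). Then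
(D) `‖V‖ ≤ K` on all of `(−∞,0) × ℝ³` — on good times `‖V(t) + b(t)‖ ≤ ‖u‖_∞` and the parasitic
drift `b` has oscillation `≤ 2‖u‖_∞` by conservation of momentum, then density and continuity —
and (E) at EVERY `t < 0`, `u(t) = V(t, · − A(t)) + c(t)` a.e. for some constant `c(t)`
(continuity of the solenoidal pairings in `t`, `IsBoundedAncientMildSolution.continuousOn_integral_inner`,
and the `L^∞` annihilator lemma, KNSS 2009 Lemma 3.1). [cite: KochNadirashviliSereginSverak2009, §1 p. 3 (parasitic solutions b(t)) and Lemma 3.1, Remark 3.1 p. 7 (arXiv:0709.3599)] -/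
theorem stub_oseen_gauge_uniform_every_slice :
    ∀ (u V : ℝ → EuclideanSpace ℝ (Fin 3) → EuclideanSpace ℝ (Fin 3))
      (A b : ℝ → EuclideanSpace ℝ (Fin 3)),
      Literature.Analysis.FluidPDE.IsBoundedAncientMildSolution 1 u →
      (∀ t < 0, AEStronglyMeasurable (u t) volume) →
      Continuous A → ContinuousOn (uncurry V) (Iio 0 ×ˢ univ) →
      (∀ t < 0, Literature.Analysis.FluidPDE.IsWeaklyDivFree (V t)) →
      (∀ s t : ℝ, s < t → t < 0 →
        Tendsto (fun R : ℝ => ⨍ y in Metric.ball (0 : EuclideanSpace ℝ (Fin 3)) R,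
          (V t y - V s y)) atTop (𝓝 0)) →
      (∀ᵐ t ∂(volume.restrict (Iio (0 : ℝ))),
        u t =ᵐ[volume] fun x => V t (x - A t) + b t) →
      (∃ K : ℝ, ∀ t < 0, ∀ y, ‖V t y‖ ≤ K) ∧
        ∃ c : ℝ → EuclideanSpace ℝ (Fin 3), ∀ t < 0,
          u t =ᵐ[volume] fun x => V t (x - A t) + c t := by
  intro u V A b hu hmeas hA hV hVdiv hmom hrep
  obtain ⟨M, hM⟩ := hu.2
  obtain ⟨K, hK⟩ := uniform_bound (fun t ht x => hM t ht x) hV hmom hrep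
  have hE : ∀ t : ℝ, t < 0 → ∃ c : EuclideanSpace ℝ (Fin 3),
      u t =ᵐ[volume] fun x => V t (x - A t) + c := fun t ht =>
    exists_const_slice hu hmeas hA hV hVdiv hK hrep ht
  choose! c hc using hE
  exact ⟨⟨K, hK⟩, c, hc⟩

end Summit.NavierStokesRegularity.NavierStokesRegularity.Theorems
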